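import Summits.QuantumFields.QCD.Theorems.SpectralDefectExtinctionWindowExtinctionStubInertiaMonotoneAux
import Summits.QuantumFields.QCD.Theorems.WindowExtinction.Negative.SpectralFlow
import Summits.QuantumFields.QCD.Theorems.SpectralDefectExtinctionWindowExtinctionSpreadTorusBoxes
import HarnessLib

/-!
# Strict monotonicity of the deep index under a box surgery (stub `stub_inertiaMonotone`)

Stub `stub_inertiaMonotone` (S7) of line `free-volume-heavy-witness` (reshape r3, "rank-monotone
cores") of crux `Summit.QuantumFields.QCD.Theses.SpectralDefectExtinction.WindowExtinction`
(item stmt-QuantumFields-8964).  Helper (2/2): the Wilson–Dirac instance of the abstract off-block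
monotonicity `inertia_offBlock_monotone` (helper 1/2, `…StubInertiaMonotoneAux`).

Let `H_σ = Γ₅ D_W(U_σ, −δ, 1)` (`SU(3)`, fundamental, `r = 1`) for two gauge fields `U, U'` on the
four-torus of side `n` that agree on every link based outside the image of the box
`c + {−R, …, R}⁴`, and let `I` ("inside") be the quark indices over that image.

* the outside blocks agree: an entry of `D_W` between two outside sites only reads links based at
  one of them (`inertia_wilsonDirac_congr`);
* the inside/outside couplings are supported on the columns over the outside sites ADJACENT to the
  image, which are of the form `proj (c + y ± e_μ)` with `y` on the face `y_μ = ±R`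
  (`inertia_exists_adjSites`: at most `8 (2R+1)³` sites, `12` indices each, `≤ 96 (2R+1)³`
  columns);
* hence (helper 1/2: Haynsworth inertia additivity + rank slack on the common kernel)
  `n₋(H) − n₋(A) ≤ n₋(H') − n₋(A') + 96 (2R+1)³` for the inside principal blocks `A, A'` when both
  are invertible, i.e. an inertia gap `n₋(A') ≥ n₋(A) + 96(2R+1)³ + 1` of the box blocks forces
  `n₋(H') ≥ n₋(H) + 1` — in EVERY environment.
-/

noncomputable section

namespace Summit.QuantumFields.QCD.Cruxes.WindowExtinction.FreeVolumeHeavyWitness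

open Matrix
open Literature.MathematicalPhysics.QuantumLattice Literature.MathematicalPhysics.QuantumFieldTheory
  Literature.Probability.LatticeModels
open Literature.MathematicalPhysics (QuantumFieldTheory.Site.shift)
open Summit.QuantumFields.QCD.Theorems.ExtinctionBuildsQCD.Negative
open scoped BigOperators Classical

/-! ## Faces of the box and the outside neighbours of its image -/

/-- A point of the box whose neighbour in direction `s e_μ` (`s = ±1`) leaves the box lies on the
face `y_μ = s R`. -/
theorem inertia_face {R : ℕ} {y : Fin 4 → ℤ} (hy : y ∈ box 4 R) (μ : Fin 4) {s : ℤ}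
    (hs : s = 1 ∨ s = -1) (hout : y + s • Pi.single μ (1 : ℤ) ∉ box 4 R) : y μ = s * R := by
  rw [mem_box] at hy hout
  obtain ⟨i, hi⟩ := not_forall.mp hout
  have hyi := hy i
  have hyμ := hy μ
  by_cases hiμ : i = μ
  · subst hiμ
    simp only [Pi.add_apply, Pi.smul_apply, Pi.single_eq_same, smul_eq_mul, mul_one] at hi
    rcases hs with rfl | rfl <;> omega
  · simp only [Pi.add_apply, Pi.smul_apply, Pi.single_eq_of_ne hiμ, smul_zero, add_zero] at hi
    exact absurd hyi hi

/-- `Torus.proj` is `ℤ`-linear. -/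
theorem inertia_proj_zsmul (n : ℕ) (s : ℤ) (v : Fin 4 → ℤ) :
    Torus.proj n (s • v) = s • Torus.proj n v := by
  funext k
  rw [Torus.proj_apply, Pi.smul_apply, Pi.smul_apply, Torus.proj_apply, smul_eq_mul, Int.cast_mul,
    zsmul_eq_mul]

/-- The image of a shifted box point: `proj (c + (y + s e_μ)) = proj (c + y) + s e_μ`. -/
theorem inertia_proj_add_zsmul_single (n : ℕ) (c y : Fin 4 → ℤ) (μ : Fin 4) (s : ℤ) :
    Torus.proj n (c + (y + s • Pi.single μ (1 : ℤ))) =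
      Torus.proj n (c + y) + s • Pi.single μ (1 : ZMod n) := by
  rw [← add_assoc, spread_proj_add, inertia_proj_zsmul, spread_proj_single]

/-- **The outside neighbours of the image of the box.**  There is a set `T` of at most `8 (2R+1)³`
torus sites containing `proj (c + y + s e_μ)` for every box point `y` pushed out of the box by
`s e_μ` (`s = ±1`): the images of the `8` faces `y_μ = s R` (each a copy of `{−R, …, R}³`) pushed
out by one step. -/
theorem inertia_exists_adjSites (n R : ℕ) (c : Fin 4 → ℤ) :
    ∃ T : Finset (TorusSite 4 n), T.card ≤ 8 * (2 * R + 1) ^ 3 ∧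
      ∀ y ∈ box 4 R, ∀ (μ : Fin 4) (s : ℤ), (s = 1 ∨ s = -1) →
        y + s • Pi.single μ (1 : ℤ) ∉ box 4 R →
          Torus.proj n (c + (y + s • Pi.single μ (1 : ℤ))) ∈ T := by
  refine ⟨((Finset.univ : Finset (Fin 4)) ×ˢ (({1, -1} : Finset ℤ) ×ˢ box 3 R)).image
      (fun t : Fin 4 × ℤ × (Fin 3 → ℤ) => Torus.proj n (c +
        (Fin.insertNth (α := fun _ => ℤ) t.1 (t.2.1 * (R : ℤ)) t.2.2 +
          t.2.1 • Pi.single t.1 (1 : ℤ)))), ?_, fun y hy μ s hs hout => ?_⟩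
  · refine Finset.card_image_le.trans ?_
    rw [Finset.card_product, Finset.card_product, Finset.card_univ, Fintype.card_fin, card_box,
      Finset.card_pair (by norm_num)]
    exact le_of_eq (by ring)
  · have hface : y μ = s * R := inertia_face hy μ hs hout
    rw [Finset.mem_image]
    refine ⟨(μ, s, Fin.removeNth (α := fun _ => ℤ) μ y), ?_, ?_⟩
    · simp only [Finset.mem_product, Finset.mem_univ, true_and, Finset.mem_insert,
        Finset.mem_singleton]
      refine ⟨hs, ?_⟩
      rw [mem_box] at hy ⊢
      exact fun i => hy _
    · dsimp only
      rw [← hface, Fin.insertNth_self_removeNth]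

/-- If `x` is in the image of the box, `x'` is not, and `x' = x + e_μ` or `x = x' + e_μ`, then `x'`
lies in any set `T` as in `inertia_exists_adjSites`. -/
theorem inertia_adj_mem {n R : ℕ} {c : Fin 4 → ℤ} {T : Finset (TorusSite 4 n)}
    (hT : ∀ y ∈ box 4 R, ∀ (μ : Fin 4) (s : ℤ), (s = 1 ∨ s = -1) →
      y + s • Pi.single μ (1 : ℤ) ∉ box 4 R → Torus.proj n (c + (y + s • Pi.single μ (1 : ℤ))) ∈ T)
    {x x' : TorusSite 4 n} (hx : ∃ y : ↥(box 4 R), Torus.proj n (c + (y : Fin 4 → ℤ)) = x)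
    (hx' : ¬ ∃ y : ↥(box 4 R), Torus.proj n (c + (y : Fin 4 → ℤ)) = x') (μ : Fin 4)
    (h : x' = QuantumFieldTheory.Site.shift x μ ∨ x = QuantumFieldTheory.Site.shift x' μ) :
    x' ∈ T := by
  obtain ⟨⟨y, hy⟩, rfl⟩ := hx
  -- `x' = proj (c + (y + s e_μ))` with `s = ±1`
  obtain ⟨s, hs, hx's⟩ : ∃ s : ℤ, (s = 1 ∨ s = -1) ∧
      x' = Torus.proj n (c + (y + s • Pi.single μ (1 : ℤ))) := by
    rcases h with h | h
    · refine ⟨1, Or.inl rfl, ?_⟩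
      rw [inertia_proj_add_zsmul_single, one_zsmul, h]
      rfl
    · refine ⟨-1, Or.inr rfl, ?_⟩
      rw [inertia_proj_add_zsmul_single, neg_one_zsmul, h, QuantumFieldTheory.Site.shift,
        add_neg_cancel_right]
  subst hx's
  by_cases hin : y + s • Pi.single μ (1 : ℤ) ∈ box 4 R
  · exact absurd ⟨⟨_, hin⟩, rfl⟩ hx'
  · exact hT y hy μ s hs hin

/-! ## Entries of the Hermitian Wilson–Dirac operator -/

section Entries

variable {n N : ℕ} {G : Type*} [Group G] (ρ : G →* Matrix (Fin N) (Fin N) ℂ)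

/-- An entry of `D_W` only reads the links based at the two sites involved. -/
theorem inertia_wilsonDirac_congr {U U' : GaugeConfig 4 n G} (m r : ℝ)
    {p q : TorusSite 4 n × Fin N × Fin 4} (hp : ∀ μ, U' (p.1, μ) = U (p.1, μ))
    (hq : ∀ μ, U' (q.1, μ) = U (q.1, μ)) : wilsonDirac ρ U' m r p q = wilsonDirac ρ U m r p q := by
  simp only [wilsonDirac, Matrix.of_apply, hp, hq]

/-- `D_W` has range one: its entry vanishes unless the two sites coincide or are neighbours. -/
theorem inertia_wilsonDirac_eq_zero (U : GaugeConfig 4 n G) (m r : ℝ)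
    {p q : TorusSite 4 n × Fin N × Fin 4} (hpq : p ≠ q)
    (h1 : ∀ μ, q.1 ≠ QuantumFieldTheory.Site.shift p.1 μ)
    (h2 : ∀ μ, p.1 ≠ QuantumFieldTheory.Site.shift q.1 μ) : wilsonDirac ρ U m r p q = 0 := by
  simp only [wilsonDirac, Matrix.of_apply, if_neg hpq, if_neg (h1 _), if_neg (h2 _), add_zero,
    Finset.sum_const_zero, mul_zero, sub_zero]

/-- Entries of `Γ₅ D_W` between two sites only read the links based at those sites. -/
theorem inertia_hermitianWilson_congr [NeZero n] {U U' : GaugeConfig 4 n G} (m r : ℝ)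
    {p q : TorusSite 4 n × Fin N × Fin 4} (hp : ∀ μ, U' (p.1, μ) = U (p.1, μ))
    (hq : ∀ μ, U' (q.1, μ) = U (q.1, μ)) :
    (spinorLift (L := n) (N := N) gammaFive * wilsonDirac ρ U' m r) p q =
      (spinorLift (L := n) (N := N) gammaFive * wilsonDirac ρ U m r) p q := by
  rw [spinorLift_gammaFive_eq_diagonal, diagonal_mul, diagonal_mul,
    inertia_wilsonDirac_congr ρ m r hp hq]

/-- `Γ₅ D_W` has range one: its entry vanishes unless the two sites coincide or are neighbours. -/
theorem inertia_hermitianWilson_eq_zero [NeZero n] (U : GaugeConfig 4 n G) (m r : ℝ)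
    {p q : TorusSite 4 n × Fin N × Fin 4} (hpq : p ≠ q)
    (h1 : ∀ μ, q.1 ≠ QuantumFieldTheory.Site.shift p.1 μ)
    (h2 : ∀ μ, p.1 ≠ QuantumFieldTheory.Site.shift q.1 μ) :
    (spinorLift (L := n) (N := N) gammaFive * wilsonDirac ρ U m r) p q = 0 := by
  rw [spinorLift_gammaFive_eq_diagonal, diagonal_mul, inertia_wilsonDirac_eq_zero ρ U m r hpq h1 h2,
    mul_zero]

end Entries

/-! ## The stub -/

/-- **STUB S7 `stub_inertiaMonotone` (strict monotonicity of the deep index under a box surgery).**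
Let `U, U'` be two `SU(3)` gauge fields on the four-torus of side `n > 2R+1` that agree on every
link based outside the image of the box `c + {−R, …, R}⁴`, and let `A, A'` be the principal blocks
of `H = Γ₅ D_W(U, −δ, 1)`, `H' = Γ₅ D_W(U', −δ, 1)` over the quark indices of that image.  If `A`
and `A'` are invertible and `n₋(A') ≥ n₋(A) + 96 (2R+1)³ + 1`, then `n₋(H') ≥ n₋(H) + 1` (negative
roots of the characteristic polynomial, with multiplicity).  Proof: `inertia_offBlock_monotone`
(Haynsworth inertia additivity + rank slack, helper 1/2) for the inside/outside splitting — the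
outside blocks of `H, H'` agree and the couplings are supported on the `≤ 96 (2R+1)³` columns over
the outside sites adjacent to the image. -/
theorem stub_inertiaMonotone :
    ∀ (n : ℕ) [NeZero n] (R : ℕ), 2 * R + 1 < n → ∀ (c : Fin 4 → ℤ) (δ : ℝ) (U U' : GaugeConfig 4 n SU3),
      (∀ e, (¬ ∃ y : ↥(box 4 R), Torus.proj n (c + (y : Fin 4 → ℤ)) = e.1) → U' e = U e) →
      ((spinorLift gammaFive * wilsonDirac (fundamentalRep (Fin 3)) U (-δ) 1).submatrix
          (Subtype.val : {p : TorusSite 4 n × Fin 3 × Fin 4 //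
            ∃ y : ↥(box 4 R), Torus.proj n (c + (y : Fin 4 → ℤ)) = p.1} → _) Subtype.val).det ≠ 0 →
      ((spinorLift gammaFive * wilsonDirac (fundamentalRep (Fin 3)) U' (-δ) 1).submatrix
          (Subtype.val : {p : TorusSite 4 n × Fin 3 × Fin 4 //
            ∃ y : ↥(box 4 R), Torus.proj n (c + (y : Fin 4 → ℤ)) = p.1} → _) Subtype.val).det ≠ 0 →
      negRootCount ((spinorLift gammaFive * wilsonDirac (fundamentalRep (Fin 3)) U (-δ) 1).submatrix
          (Subtype.val : {p : TorusSite 4 n × Fin 3 × Fin 4 //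
            ∃ y : ↥(box 4 R), Torus.proj n (c + (y : Fin 4 → ℤ)) = p.1} → _) Subtype.val) +
          96 * (2 * R + 1) ^ 3 + 1 ≤
        negRootCount ((spinorLift gammaFive * wilsonDirac (fundamentalRep (Fin 3)) U' (-δ) 1).submatrix
          (Subtype.val : {p : TorusSite 4 n × Fin 3 × Fin 4 //
            ∃ y : ↥(box 4 R), Torus.proj n (c + (y : Fin 4 → ℤ)) = p.1} → _) Subtype.val) →
      (spinorLift gammaFive * wilsonDirac (fundamentalRep (Fin 3)) U (-δ) 1).charpoly.roots.countP
            (fun z : ℂ => z.re < 0) + 1 ≤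
        (spinorLift gammaFive * wilsonDirac (fundamentalRep (Fin 3)) U' (-δ) 1).charpoly.roots.countP
            (fun z : ℂ => z.re < 0) := by
  intro n _ R _ c δ U U' hUU' hA hA' hgap
  set H : Matrix (TorusSite 4 n × Fin 3 × Fin 4) (TorusSite 4 n × Fin 3 × Fin 4) ℂ :=
    spinorLift gammaFive * wilsonDirac (fundamentalRep (Fin 3)) U (-δ) 1
  set H' : Matrix (TorusSite 4 n × Fin 3 × Fin 4) (TorusSite 4 n × Fin 3 × Fin 4) ℂ :=
    spinorLift gammaFive * wilsonDirac (fundamentalRep (Fin 3)) U' (-δ) 1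
  -- the boundary columns: indices over the outside sites adjacent to the image of the box
  obtain ⟨T, hTcard, hT⟩ := inertia_exists_adjSites n R c
  set K : Finset (TorusSite 4 n × Fin 3 × Fin 4) := T ×ˢ Finset.univ with hKdef
  have hK : K.card ≤ 96 * (2 * R + 1) ^ 3 := by
    have h2 : K.card = T.card * 12 := by
      rw [hKdef, Finset.card_product, Finset.card_univ, Fintype.card_prod, Fintype.card_fin,
        Fintype.card_fin]
    rw [h2]
    calc T.card * 12 ≤ 8 * (2 * R + 1) ^ 3 * 12 := Nat.mul_le_mul_right _ hTcard
      _ = 96 * (2 * R + 1) ^ 3 := by ring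
  -- Hermiticity of `Γ₅ D_W` (γ₅-hermiticity, unitary colour representation)
  have hH : H.IsHermitian :=
    Literature.Barriers.QuantumFields.WilsonDeterminant.isHermitian_hermitianWilsonDirac _
      fundamentalRep_mem_unitaryGroup U (-δ) 1
  have hH' : H'.IsHermitian :=
    Literature.Barriers.QuantumFields.WilsonDeterminant.isHermitian_hermitianWilsonDirac _
      fundamentalRep_mem_unitaryGroup U' (-δ) 1
  -- the outside blocks agree: an outside/outside entry only reads links based outside
  have hS : ∀ p q : TorusSite 4 n × Fin 3 × Fin 4,
      ¬ (∃ y : ↥(box 4 R), Torus.proj n (c + (y : Fin 4 → ℤ)) = p.1) →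
      ¬ (∃ y : ↥(box 4 R), Torus.proj n (c + (y : Fin 4 → ℤ)) = q.1) → H' p q = H p q :=
    fun p q hp hq => inertia_hermitianWilson_congr (fundamentalRep (Fin 3)) (-δ) 1
      (fun μ => hUU' (p.1, μ) hp) (fun μ => hUU' (q.1, μ) hq)
  -- the inside/outside couplings are supported on the boundary columns (range one)
  have hB : ∀ (V : GaugeConfig 4 n SU3) (p q : TorusSite 4 n × Fin 3 × Fin 4),
      (∃ y : ↥(box 4 R), Torus.proj n (c + (y : Fin 4 → ℤ)) = p.1) →
      ¬ (∃ y : ↥(box 4 R), Torus.proj n (c + (y : Fin 4 → ℤ)) = q.1) → q ∉ K →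
        (spinorLift (L := n) (N := 3) gammaFive * wilsonDirac (fundamentalRep (Fin 3)) V (-δ) 1) p q
          = 0 := by
    intro V p q hp hq hqK
    have hqK' : q.1 ∉ T := fun h =>
      hqK (by rw [hKdef, Finset.mem_product]; exact ⟨h, Finset.mem_univ _⟩)
    have hpq : p ≠ q := by
      rintro rfl
      exact hq hp
    exact inertia_hermitianWilson_eq_zero (fundamentalRep (Fin 3)) V (-δ) 1 hpq
      (fun μ h => hqK' (inertia_adj_mem hT hp hq μ (Or.inl h)))
      (fun μ h => hqK' (inertia_adj_mem hT hp hq μ (Or.inr h)))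
  -- Haynsworth inertia additivity + rank slack (helper 1/2)
  have h := inertia_offBlock_monotone
    (fun p : TorusSite 4 n × Fin 3 × Fin 4 =>
      ∃ y : ↥(box 4 R), Torus.proj n (c + (y : Fin 4 → ℤ)) = p.1)
    K hH hH' hS (hB U) (hB U') hA hA'
  change negRootCount H + 1 ≤ negRootCount H'
  generalize 96 * (2 * R + 1) ^ 3 = t at hK hgap
  omega

end Summit.QuantumFields.QCD.Cruxes.WindowExtinction.FreeVolumeHeavyWitness

end
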